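import Literature.Geometry.Lorentzian.StationaryFinalStateDecomposition
import Mathlib.Analysis.Calculus.InverseFunctionTheorem.FDeriv
import Mathlib.Analysis.Calculus.ContDiff.RCLike
import HarnessLib

/-!
# Route ZeroEnergyKerrOrBomb · crux `StationaryLimitReduction` (stmt-FinalStateConjecture-10021), line
# `symplectic-dual-of-the-bomb` — an isometric identification of the Kerr exterior is an OPEN EMBEDDING
# (the embedding clause of the re-adapted late charts of `stub_chartTransfer`)

Helper file (`--supports stmt-FinalStateConjecture-10021`; registered helper `kerrCharted_isOpenEmbedding`)
from the lead's wave-1 stub-worker for `stub_chartTransfer` (lead prover-line-stmt-FinalStateConjecture-10021-a1-0,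
2026-08-16). The conclusion `IsKerrCharted 𝓑 A` of the neighbouring stub gives a map `Θ` smooth and
injective on a Kerr–Schild region, ISOMETRIC on the exterior `{r > r₊}` from `Kerr.bilin M a` to the chart
components `A.bilin`, but says nothing about openness of `Θ` or continuity of `Θ⁻¹`, which the clause
`IsLateChart.isOpenEmbedding` of the re-adapted chart `ψ ∘ Φ̂` needs. It is automatic:

* `fderiv_injective_of_isometry` — an isometry clause `B₁ (Θ x)(DΘ v, DΘ w) = B₂ x (v, w)` with `B₂ x`
  nondegenerate forces `DΘ(x)` injective;
* `map_nhds_eq_of_isometry` — hence (finite dimension: injective ⇒ surjective; Mathlib's inverse function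
  theorem `HasStrictFDerivAt.map_nhds_eq_of_surj`) `Θ` maps neighbourhoods onto neighbourhoods;
* `isOpenMap_restrict_of_isometry`, `isOpenEmbedding_restrict_of_isometry` — `Θ` restricted to the open
  set is an open map, and an open embedding if injective there;
* `kerrCharted_isOpenEmbedding` (registered, binder-free) — for the data of `IsKerrCharted`: `Θ` restricted
  to `Kerr.exterior M a` is an open embedding into `E4` and `Θ '' Kerr.exterior M a` is open
  (`Kerr.bilin_nondegenerate` on `{r > 0}`).

Elementary; no named fact, nothing restated. References: O'Neill 1983, Ch. 3, p. 58 (isometries are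
local diffeomorphisms); Kerr–Schild 1965, §2 (nondegeneracy of the Kerr–Schild form).
-/

-- every `Summit.FinalStateConjecture.FinalStateConjecture.…` name repeats the summit = sub-problem segment (D-0017 layout)
set_option linter.dupNamespace false

noncomputable section

open scoped Topology Manifold ContDiff
open Set Filter Function

namespace Summit.FinalStateConjecture.FinalStateConjecture.Theorems.SymplecticDualOfTheBomb

open Literature.Geometry.Lorentzian

section OpenMap

variable {Θ : E4 → E4} {S : Set E4}

/-- **An isometry clause forces an injective differential**: if `B₁ (DΘ v) (DΘ w) = B₂ v w` for all
`v, w` and `B₂` is nondegenerate, then `DΘ` is injective. [folklore] -/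
theorem fderiv_injective_of_isometry {x : E4} {B₁ B₂ : E4 →L[ℝ] E4 →L[ℝ] ℝ}
    (hiso : ∀ v w : E4, B₁ (fderiv ℝ Θ x v) (fderiv ℝ Θ x w) = B₂ v w)
    (hB₂ : ∀ v : E4, (∀ w, B₂ v w = 0) → v = 0) :
    Injective (fderiv ℝ Θ x) := by
  refine (injective_iff_map_eq_zero _).2 fun v hv ↦ hB₂ v fun w ↦ ?_
  rw [← hiso, hv, map_zero]
  rfl

/-- **Neighbourhoods go onto neighbourhoods** (inverse function theorem): a `C¹` map on an open set
whose differential at `x` is injective — e.g. by an isometry clause with nondegenerate `B₂ x` — satisfies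
`map Θ (𝓝 x) = 𝓝 (Θ x)`. [folklore] -/
theorem map_nhds_eq_of_isometry (hS : IsOpen S) (hΘ : ContDiffOn ℝ 1 Θ S) {x : E4} (hx : x ∈ S)
    {B₁ B₂ : E4 →L[ℝ] E4 →L[ℝ] ℝ}
    (hiso : ∀ v w : E4, B₁ (fderiv ℝ Θ x v) (fderiv ℝ Θ x w) = B₂ v w)
    (hB₂ : ∀ v : E4, (∀ w, B₂ v w = 0) → v = 0) :
    map Θ (𝓝 x) = 𝓝 (Θ x) := by
  have hstrict : HasStrictFDerivAt Θ (fderiv ℝ Θ x) x :=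
    (hΘ.contDiffAt (hS.mem_nhds hx)).hasStrictFDerivAt one_ne_zero
  refine hstrict.map_nhds_eq_of_surj (LinearMap.range_eq_top.2 ?_)
  exact LinearMap.injective_iff_surjective.1 (fderiv_injective_of_isometry hiso hB₂)

/-- **Open map.** A `C¹` map on an open set `S`, isometric there from nondegenerate forms `B₂ x` to forms
`B₁ (Θ x)`, restricts to an open map `S → E4`. [folklore] -/
theorem isOpenMap_restrict_of_isometry (hS : IsOpen S) (hΘ : ContDiffOn ℝ 1 Θ S)
    (B₁ B₂ : E4 → E4 →L[ℝ] E4 →L[ℝ] ℝ)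
    (hiso : ∀ x ∈ S, ∀ v w : E4, B₁ (Θ x) (fderiv ℝ Θ x v) (fderiv ℝ Θ x w) = B₂ x v w)
    (hB₂ : ∀ x ∈ S, ∀ v : E4, (∀ w, B₂ x v w = 0) → v = 0) :
    IsOpenMap (S.restrict Θ) := by
  rw [isOpenMap_iff_nhds_le]
  rintro ⟨x, hx⟩
  have h := map_nhds_eq_of_isometry hS hΘ hx (hiso x hx) (hB₂ x hx)
  have hres : S.restrict Θ = Θ ∘ (Subtype.val : S → E4) := rfl
  rw [hres, ← Filter.map_map, map_nhds_subtype_val, hS.nhdsWithin_eq hx, h]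
  exact le_rfl

/-- **Open embedding.** If moreover `Θ` is injective on `S`, its restriction is an open embedding
`S → E4`; in particular `Θ '' S` is open. [folklore] -/
theorem isOpenEmbedding_restrict_of_isometry (hS : IsOpen S) (hΘ : ContDiffOn ℝ 1 Θ S)
    (hinj : InjOn Θ S) (B₁ B₂ : E4 → E4 →L[ℝ] E4 →L[ℝ] ℝ)
    (hiso : ∀ x ∈ S, ∀ v w : E4, B₁ (Θ x) (fderiv ℝ Θ x v) (fderiv ℝ Θ x w) = B₂ x v w)
    (hB₂ : ∀ x ∈ S, ∀ v : E4, (∀ w, B₂ x v w = 0) → v = 0) :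
    Topology.IsOpenEmbedding (S.restrict Θ) :=
  Topology.IsOpenEmbedding.of_continuous_injective_isOpenMap
    (hΘ.continuousOn.comp_continuous continuous_subtype_val fun x ↦ x.2)
    (injOn_iff_injective.1 hinj) (isOpenMap_restrict_of_isometry hS hΘ B₁ B₂ hiso hB₂)

end OpenMap

/-- **Registered helper `kerrCharted_isOpenEmbedding`.** For the data of `IsKerrCharted 𝓑 A` — `Θ`
smooth and injective on `Kerr.region a r₀`, `r₀ < r₊`, isometric on `Kerr.exterior M a` from
`Kerr.bilin M a` to `A.bilin` — the restriction of `Θ` to the exterior is an OPEN EMBEDDING into `E4`, and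
`Θ '' Kerr.exterior M a` (the chart preimage of the d.o.c., by the anchoring clause) is open. [folklore] -/
theorem kerrCharted_isOpenEmbedding : ∀ (𝓑 : StationaryAFBlackHole.{0}) (A : 𝓑.AdaptedChart) (M a r₀ : ℝ) (Θ : E4 → E4), r₀ ≤ Kerr.rPlus M a → ContDiffOn ℝ ∞ Θ (Kerr.region a r₀ : Set E4) → Set.InjOn Θ (Kerr.region a r₀ : Set E4) → (∀ x ∈ (Kerr.exterior M a : Set E4), ∀ v w : E4, A.bilin (Θ x) (fderiv ℝ Θ x v) (fderiv ℝ Θ x w) = Kerr.bilin M a x v w) → Topology.IsOpenEmbedding ((Kerr.exterior M a : Set E4).restrict Θ) ∧ IsOpen (Θ '' (Kerr.exterior M a : Set E4)) := by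
  intro 𝓑 A M a r₀ Θ hr₀ hΘs hinj hiso
  have hsub : (Kerr.exterior M a : Set E4) ⊆ (Kerr.region a r₀ : Set E4) := fun z hz ↦
    Kerr.mem_region.2 ((max_le_max hr₀ le_rfl).trans_lt (Kerr.mem_exterior.1 hz))
  have hΘ1 : ContDiffOn ℝ 1 Θ (Kerr.exterior M a : Set E4) :=
    (hΘs.mono hsub).of_le (by exact_mod_cast le_top)
  have hemb := isOpenEmbedding_restrict_of_isometry (Kerr.exterior M a).isOpen hΘ1 (hinj.mono hsub)
    A.bilin (Kerr.bilin M a) hiso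
    (fun x hx v hv ↦ Kerr.bilin_nondegenerate M a (Kerr.radius_pos_of_mem_region hx) v hv)
  refine ⟨hemb, ?_⟩
  rw [image_eq_range]
  exact hemb.isOpen_range

end Summit.FinalStateConjecture.FinalStateConjecture.Theorems.SymplecticDualOfTheBomb

end
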